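import Literature.AlgebraicGeometry.AbelianSchemes.AbelianSchemeOfLiftedGroupLaw
import Literature.AlgebraicGeometry.AbelianSchemes.AbelianSchemeLiftRelDim
import Literature.AlgebraicGeometry.Deformation.MorphismLiftsSquareZeroSmoothAffine
import HarnessLib

/-!
# A smooth proper lift of an abelian scheme whose group law lifts IS an abelian scheme of the same relative dimension
# ([MumfordFogartyKirwan1994] Ch. 6 §3 Prop. 6.15, packaged for the moduli consumers: section, group law, relative dimension)

Topic `Literature/AlgebraicGeometry/AbelianSchemes`; namespace `Literature.AlgebraicGeometry.AbelianSchemes.AbelianSchemeOver`.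
THEOREMS ONLY (no definition, no named fact, no instance, no notation, no `sorry`; net Literature debt 0).
Cell hodgecm-mathlib (D-0151), F-11 (A4b) ∕ F-4 II-a packaging (hand B-p04 (g22)); consumers: F-11 α1∕(A4) `stub_abelianLift`
(«SOME abelian lift of `A₀` over `Spec A` exists», fed by (A4a) «a smooth proper lift of the SCHEME exists» and (E) «the law
lifts»), F-4 II-a.  HC_CM is proved only modulo the 7 printed citations until rung 0 closes; this file discharges none of them.

* `exists_section_of_isPullback_specMap_mk` — the identity section of `A₀` LIFTS to a section of the smooth `X → Spec A`
  ([SGA1] III Cor. 5.2 for the affine `Spec A` and its nilpotent thickening of `Spec (A⧸J)`: ★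
  `Deformation.exists_lift_of_smooth_affine` on an affine open of `X` through the point);
* **`exists_abelianSchemeOver_of_isPullback_of_liftLaw`** — [MumfordFogartyKirwan1994] Prop. 6.15 modulo its existence half
  (E): `A` Artin local, `J ≠ ⊤`, `A₀` an abelian scheme of relative dimension `g` over `Spec (A⧸J)`, `X → Spec A` proper smooth
  with a cartesian `G : A₀.X → X`, and SOME `S`-morphism `m : X ×_S X → X` lifting the law ⇒ an abelian scheme `𝒳` on `X` of
  relative dimension `g` of which `A₀` is the base change along `G` (★ `exists_grpObj_isBaseChangeVia_of_lift` + ★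
  `IsOfRelDim.of_isPullback_specMap_mk`).

## References
* [MumfordFogartyKirwan1994] D. Mumford, J. Fogarty, F. Kirwan, *Geometric Invariant Theory*, 3rd ed. (1994), Ch. 6 §3 Prop. 6.15
  (p. 124) and its proof (p. 125).
* [SGA1] A. Grothendieck, M. Raynaud, *SGA 1*, LNM 224 ∕ arXiv:math/0206203, Exp. III §5 Cor. 5.2 (arXiv ed. p. 71).
-/

noncomputable section

set_option backward.isDefEq.respectTransparency false

universe u

open CategoryTheory CategoryTheory.Limits AlgebraicGeometry MonoidalCategory CartesianMonoidalCategory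
open scoped MonObj

namespace Literature.AlgebraicGeometry.AbelianSchemes.AbelianSchemeOver

variable {A : Type u} [CommRing A] [IsArtinianRing A] [IsLocalRing A] {J : Ideal A} (hJ : J ≠ ⊤)
  {A₀ : AbelianSchemeOver (Spec (.of (A ⧸ J)))} {X : Over (Spec (.of A))} {G : A₀.X.left ⟶ X.left}
  (hG : IsPullback G A₀.X.hom X.hom (Spec.map (CommRingCat.ofHom (Ideal.Quotient.mk J))))

include hJ hG in
/-- **The identity section lifts** ([SGA1] III Cor. 5.2): for `X → Spec A` smooth (`A` Artin local) with base change `A₀.X` to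
`Spec (A⧸J)` (`J ≠ ⊤`, hence nilpotent), the point `η[A₀.X] : Spec (A⧸J) → A₀.X → X` extends to a section `ε : Spec A → X`
(★ `Deformation.exists_lift_of_smooth_affine` in an affine open of `X` through the point — `Spec (A⧸J)` has one point).
[cite: SGA1, Exp. III §5 Cor. 5.2] [cite: MumfordFogartyKirwan1994, Ch. 6 §3 Proposition 6.15 (p. 124)] -/
theorem exists_section_of_isPullback_specMap_mk [Smooth X.hom] :
    ∃ ε : Spec (.of A) ⟶ X.left, ε ≫ X.hom = 𝟙 _ ∧
      η[A₀.X].left ≫ G = Spec.map (CommRingCat.ofHom (Ideal.Quotient.mk J)) ≫ ε := by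
  haveI := LiftedLaw.subsingleton_spec (A := A)
  haveI : Nontrivial (A ⧸ J) := Ideal.Quotient.nontrivial_iff.mpr hJ
  -- an affine open of `X` through the image of the (unique) point of `Spec (A⧸J)`
  have hsub : Subsingleton ↥(Spec (CommRingCat.of (A ⧸ J))) :=
    (PrimeSpectrum.comap_injective_of_surjective (Ideal.Quotient.mk J) Ideal.Quotient.mk_surjective).subsingleton
  obtain ⟨p₀⟩ : Nonempty ↥(Spec (CommRingCat.of (A ⧸ J))) := inferInstanceAs (Nonempty (PrimeSpectrum (A ⧸ J)))
  let f₀ : Spec (.of (A ⧸ J)) ⟶ X.left := η[A₀.X].left ≫ G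
  obtain ⟨V, hV, hxV, -⟩ := exists_isAffineOpen_mem_and_subset (X := X.left) (x := f₀.base p₀) (U := ⊤) trivial
  have hf₀V : f₀ ⁻¹ᵁ V = ⊤ := top_le_iff.mp fun y _ => by
    show f₀.base y ∈ V
    rw [Subsingleton.elim y p₀]; exact hxV
  have hη : η[A₀.X].left ≫ A₀.X.hom = 𝟙 _ := Over.w η[A₀.X]
  have w₀ : f₀ ≫ X.hom = Spec.map (CommRingCat.ofHom (algebraMap A (A ⧸ J))) := by
    rw [Ideal.Quotient.algebraMap_eq]
    show (η[A₀.X].left ≫ G) ≫ X.hom = _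
    rw [Category.assoc, hG.w, ← Category.assoc, hη]
    exact Category.id_comp _
  have hnil : IsNilpotent (RingHom.ker ((Ideal.Quotient.mkₐ A J : A →ₐ[A] A ⧸ J) : A →+* A ⧸ J)) := by
    rw [Ideal.Quotient.mkₐ_ker]
    exact LiftedLaw.isNilpotent_of_ne_top hJ
  obtain ⟨ε, -, hε₁, hε₂⟩ := Deformation.exists_lift_of_smooth_affine X.hom (Ideal.Quotient.mkₐ A J) hV
    (Ideal.Quotient.mkₐ_surjective A J) hnil f₀ w₀ hf₀V
  refine ⟨ε, ?_, ?_⟩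
  · rw [hε₁, Algebra.algebraMap_self, CommRingCat.ofHom_id, Spec.map_id]
  · exact hε₂.symm

include hJ in
/-- **[MumfordFogartyKirwan1994] Prop. 6.15 modulo its existence half (E), packaged for the moduli functor**: `A` an Artin
local ring, `J ≠ ⊤`, `A₀` an abelian scheme over `Spec (A⧸J)` of relative dimension `g`, `X → Spec A` proper and smooth with a
cartesian square `G : A₀.X → X` over `Spec (A⧸J) ↪ Spec A`, and SOME `S`-morphism `m : X ×_S X → X` lifting the law of `A₀`.
Then `X` carries a group-object structure making it an abelian scheme over `Spec A` of relative dimension `g` of which `A₀` is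
the base change along `G` as a group scheme (★ `IsBaseChangeVia`) — the consumer packages `⟨AbelianSchemeOver.mk X …, …⟩`.  Assembly: the section lifts (`exists_section_of_isPullback_specMap_mk`),
★ `exists_grpObj_isBaseChangeVia_of_lift` (shears, rigidity, group object), ★ `IsOfRelDim.of_isPullback_specMap_mk`.
[cite: MumfordFogartyKirwan1994, Ch. 6 §3 Proposition 6.15 (p. 124) and its proof (p. 125)] -/
theorem exists_abelianSchemeOver_of_isPullback_of_liftLaw [IsProper X.hom] [Smooth X.hom] {g : ℕ} (hg : A₀.IsOfRelDim g)
    (m : X ⊗ X ⟶ X)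
    (hm : μ[A₀.X].left ≫ G = pullback.map A₀.X.hom A₀.X.hom X.hom X.hom G G
      (Spec.map (CommRingCat.ofHom (Ideal.Quotient.mk J))) hG.w.symm hG.w.symm ≫ m.left) :
    ∃ (GX : GrpObj X) (hgc : GeometricallyConnected X.hom),
      (@AbelianSchemeOver.mk _ X GX ‹IsProper X.hom› ‹Smooth X.hom› hgc).IsOfRelDim g ∧
      A₀.IsBaseChangeVia (@AbelianSchemeOver.mk _ X GX ‹IsProper X.hom› ‹Smooth X.hom› hgc)
        (Spec.map (CommRingCat.ofHom (Ideal.Quotient.mk J))) G := by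
  obtain ⟨ε, hε₁, hε⟩ := exists_section_of_isPullback_specMap_mk hJ hG
  obtain ⟨GX, hgc, -, hbc⟩ := exists_grpObj_isBaseChangeVia_of_lift hJ hG ε hε₁ hε m hm
  exact ⟨GX, hgc, IsOfRelDim.of_isPullback_specMap_mk hJ A₀ _ hG hg, hbc⟩

end Literature.AlgebraicGeometry.AbelianSchemes.AbelianSchemeOver

end
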